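import Literature.Analysis.InnerProduct.IkedaIsospectralLensSpaces
import Mathlib.Algebra.Polynomial.Reverse
import Mathlib.Algebra.Polynomial.Degree.SmallDegree
import HarnessLib

/-!
# Ikeda's Proposition 1.2: the coefficients of `Ψ_{q,k}(z) = ∑_{l=1}^{q−1}∏_{i=1}^{k}(z − γ^{pᵢl})(z − γ^{−pᵢl}) = ∑_{i=0}^{2k}(−1)^i a_i z^{2k−i}` —
# (i) `a_i = a_{2k−i}`, (ii) `a₀ = q − 1`, (iii) `a₁ = −2k`, (iv) `a₂ = k(q − 2k + 1)` — for every `k`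

Layer `Literature/Analysis/InnerProduct`, namespace `Literature.Analysis.InnerProduct`; lane `lit-hodgefound`, prover seat
`lit-hodgefound-p06`, generation 44, self-proposed row g44-#8 — the sequel BY IMPORT of row g44-#3 (`IkedaIsospectralLensSpaces.lean`:
`ikedaPolynomial q ω = Ψ_{q,k}(ω) = ∑_{l=1}^{q−1}∏ᵢ(X² − 2cos(2πlωᵢ/q)X + 1) ∈ ℝ[X]`, `IsIkedaWeights q ω` = `ω ∈ Ĩ₀(q, k)`, the sums
`sum_Ico_cos_two_pi_mul_div` (`∑_{l=1}^{q−1}cos(2πlw/q) = −1`, `q ∤ w`) and `sum_Ico_cos_mul_cos` (`∑_{l=1}^{q−1}cos(2πla/q)cos(2πlb/q) = −1`,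
`q ∤ a ± b`), and the CLOSED FORMS for `k = 2` (`ikedaPolynomial_fin_two`, Corollary 1.3) and — row g44-#4 — `k = 3`). Here `k` is
arbitrary: the top three and the bottom three coefficients of `Ψ_{q,k}` and its palindromy, exactly Proposition 1.2 (i)–(iv) as printed.
THEOREMS ONLY (no definition, no instance, no notation, no named fact); Mathlib supplies `Polynomial.reverse` (`reverse_mul_of_domain`,
`coeff_reverse`), `natDegree_prod_of_monic`, `natDegree_quadratic`/`leadingCoeff_quadratic`.

## Source, verbatim (held text `paper:doi-10-24033-asens-1384`, p. 306 = p0005)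

A. Ikeda, *On lens spaces which are isospectral but not isometric*, Ann. Sci. ÉNS (4) **13** (1980) 303–315, §1: "(1.5)
`Ψ_{q,k}((p₁, …, p_k)) = ∑_{l=1}^{q−1}∏_{i=1}^{k}(z − γ^{pᵢl})(z − γ^{−pᵢl})`" (p0004); "**PROPOSITION 1.2.** — If we put `Ψ_{q,k}((p₁, …, p_k)) =
∑_{i=0}^{2k}(−1)^i a_i z^{2k−i}`, then we have: (i) `a_i = a_{2k−i}`; (ii) `a₀ = (q−1)`; (iii) `a₁ = −2k`; (iv) `a₂ = k(q − 2k + 1)`. *Proof.* —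
Since we have `(z − γ^{pᵢl})(z − γ^{−pᵢl}) = (γ^{pᵢl}z − 1)(γ^{−pᵢl}z − 1)`: (i) is easy to see, (ii) is clear. On the other hand, `a₁ =
∑_{l=1}^{q−1}∑_{i=1}^{k}(γ^{pᵢl} + γ^{−pᵢl}) = 2∑_{i=1}^{k}∑_{l=1}^{q−1}γ^{pᵢl} = −2k`, and `a₂ = ∑_{l=1}^{q−1}(∑_{1≤i<j≤k}(γ^{pᵢl} +
γ^{−pᵢl})(γ^{p_jl} + γ^{−p_jl}) + k) = −2(2·C(k,2)) + k(q−1) = k(q − 2k + 1)`. Thus (iii) and (iv) have been shown. QED" (p0005). Here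
`(p₁, …, p_k) ∈ Ĩ₀(q, k)` (`q` an odd prime, `pᵢ` prime to `q`, `pᵢ ≢ ±p_j`), `(z − γ^{pl})(z − γ^{−pl}) = z² − 2cos(2πlp/q)z + 1`.

## The dictionary and the proof as formalised

With `cᵢ = 2cos(2πlωᵢ/q)` the `l`-th product is `P = ∏ᵢ(X² − cᵢX + 1)`; by induction on the set of factors (§1) `P` is monic of degree
`2k` with BOTTOM coefficients `[X⁰]P = 1`, `[X¹]P = −∑ᵢcᵢ`, `[X²]P = k + ∑_{i<j}cᵢc_j = k + ((∑ᵢcᵢ)² − ∑ᵢcᵢ²)/2`, and `P` is PALINDROMIC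
(`reverse P = P`, each factor being so; `reverse` is multiplicative over the domain `ℝ`), so `[X^{2k−j}]P = [X^j]P`. Summing over
`1 ≤ l ≤ q−1` (§2): `[X^j]Ψ = [X^{2k−j}]Ψ` — this is (i), since `a_i = (−1)^i[X^{2k−i}]Ψ` and `i ≡ 2k − i (mod 2)`; `[X^{2k}]Ψ = [X⁰]Ψ = q − 1`
— (ii); `[X^{2k−1}]Ψ = [X¹]Ψ = −∑ᵢ∑_l 2cos(2πlωᵢ/q) = 2k` (`q ∤ ωᵢ`) — (iii) (`a₁ = −[X^{2k−1}]Ψ = −2k`); `[X^{2k−2}]Ψ = [X²]Ψ = k(q−1) +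
∑_{i<j}∑_l 4cos(2πlωᵢ/q)cos(2πlω_j/q) = k(q−1) − 4·C(k,2) = k(q − 2k + 1)` (`q ∤ ωᵢ ± ω_j`) — (iv).

## What is proved

* §1 (products of palindromic quadratics, any index set): `monic_prod_quadratic`, `natDegree_prod_quadratic`, **`coeff_prod_quadratic_zero/one/two`**,
  **`reverse_prod_quadratic`**, **`coeff_prod_quadratic_rev`** (`[X^{2|s|−j}]P = [X^j]P`).
* §2 (PROPOSITION 1.2): **`coeff_ikedaPolynomial_rev`** ((i): `[X^j]Ψ_{q,k} = [X^{2k−j}]Ψ_{q,k}`), **`coeff_ikedaPolynomial_zero`** /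
  **`coeff_ikedaPolynomial_two_mul`** ((ii): `= q − 1`), `natDegree_ikedaPolynomial`, `leadingCoeff_ikedaPolynomial`, **`coeff_ikedaPolynomial_one`** /
  **`coeff_ikedaPolynomial_two_mul_sub_one`** ((iii): `= 2k`, for weights `≢ 0`), **`IsIkedaWeights.coeff_ikedaPolynomial_two`** /
  **`IsIkedaWeights.coeff_ikedaPolynomial_two_mul_sub_two`** ((iv): `= k(q − 2k + 1)` on `Ĩ₀(q, k)`).

## References

* [Ikeda1980] A. Ikeda, *On lens spaces which are isospectral but not isometric*, Ann. Sci. ÉNS (4) 13 (1980) 303–315, §1 (1.5),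
  Proposition 1.2 (i)–(iv), Corollary 1.3.
* [IkedaYamamoto1979] A. Ikeda, Y. Yamamoto, *On the spectra of 3-dimensional lens spaces*, Osaka J. Math. 16 (1979) 447–469, §3 (the
  factors `(1 − γ^{pᵢl}z)(1 − γ^{−pᵢl}z)` of the generating function).
-/

noncomputable section

namespace Literature.Analysis.InnerProduct

open Finset Polynomial
open _root_.Real

/-! ### §1 Products of the palindromic quadratics `X² − cX + 1` -/

section Quadratic

variable {ι : Type*}

/-- `X² − bX + 1 = 1·X² + (−b)·X + 1` in Mathlib's normal form for quadratics. [folklore] -/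
private theorem quadratic_eq (b : ℝ) : (X ^ 2 - C b * X + 1 : ℝ[X]) = C 1 * X ^ 2 + C (-b) * X + C 1 := by
  simp only [map_one, one_mul, map_neg, neg_mul]
  ring

/-- `X² − bX + 1` is monic. [folklore] -/
private theorem monic_quadratic (b : ℝ) : (X ^ 2 - C b * X + 1 : ℝ[X]).Monic := by
  rw [Monic, quadratic_eq, leadingCoeff_quadratic one_ne_zero]

/-- `deg(X² − bX + 1) = 2`. [folklore] -/
private theorem natDegree_quadratic_eq (b : ℝ) : (X ^ 2 - C b * X + 1 : ℝ[X]).natDegree = 2 := by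
  rw [quadratic_eq]
  exact natDegree_quadratic one_ne_zero

/-- The coefficients of `X² − bX + 1`: `1, −b, 1, 0, 0, …`. [folklore] -/
private theorem coeff_quadratic (b : ℝ) (n : ℕ) :
    (X ^ 2 - C b * X + 1 : ℝ[X]).coeff n = if n = 0 then 1 else if n = 1 then -b else if n = 2 then 1 else 0 := by
  simp only [coeff_add, coeff_sub, coeff_X_pow, coeff_C_mul_X, coeff_one]
  rcases n with _ | _ | _ | n
  · simp
  · simp
  · simp
  · simp only [show n + 3 ≠ 2 by omega, show n + 3 ≠ 1 by omega, show n + 3 ≠ 0 by omega, if_false]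
    ring

/-- `X² − bX + 1` is palindromic: `reverse (X² − bX + 1) = X² − bX + 1`. [folklore] -/
private theorem reverse_quadratic (b : ℝ) : (X ^ 2 - C b * X + 1 : ℝ[X]).reverse = X ^ 2 - C b * X + 1 := by
  ext n
  rw [coeff_reverse, natDegree_quadratic_eq, coeff_quadratic, coeff_quadratic]
  rcases n with _ | _ | _ | n
  · rw [revAt_le (by norm_num)]; simp
  · rw [revAt_le (by norm_num)]
  · rw [revAt_le (by norm_num)]; simp
  · rw [revAt_eq_self_of_lt (by omega)]

/-- `∏_{i∈s}(X² − cᵢX + 1)` is monic (the `l`-th term of `Ψ_{q,k}`, (1.5)). [cite: Ikeda1980, §1 (1.5) and Proposition 1.2 (ii)] -/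
theorem monic_prod_quadratic (s : Finset ι) (c : ι → ℝ) : (∏ i ∈ s, (X ^ 2 - C (c i) * X + 1 : ℝ[X])).Monic :=
  monic_prod_of_monic s _ fun i _ ↦ monic_quadratic (c i)

/-- `deg ∏_{i∈s}(X² − cᵢX + 1) = 2|s|`. [cite: Ikeda1980, §1 (1.5) (`Ψ_{q,k}` has degree `2k`)] -/
theorem natDegree_prod_quadratic (s : Finset ι) (c : ι → ℝ) :
    (∏ i ∈ s, (X ^ 2 - C (c i) * X + 1 : ℝ[X])).natDegree = 2 * s.card := by
  rw [natDegree_prod_of_monic _ _ fun i _ ↦ monic_quadratic (c i)]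
  simp_rw [natDegree_quadratic_eq]
  rw [sum_const, smul_eq_mul, mul_comm]

/-- The bottom coefficients of a quadratic times a polynomial: `[X⁰]((X² − bX + 1)P) = [X⁰]P`, `[X¹] = [X¹]P − b[X⁰]P`,
`[X²] = [X²]P − b[X¹]P + [X⁰]P`. [folklore] -/
private theorem coeff_quadratic_mul (b : ℝ) (P : ℝ[X]) :
    ((X ^ 2 - C b * X + 1) * P).coeff 0 = P.coeff 0 ∧ ((X ^ 2 - C b * X + 1) * P).coeff 1 = P.coeff 1 - b * P.coeff 0 ∧
      ((X ^ 2 - C b * X + 1) * P).coeff 2 = P.coeff 2 - b * P.coeff 1 + P.coeff 0 := by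
  have e : (X ^ 2 - C b * X + 1 : ℝ[X]) * P = X ^ 2 * P - C b * (X * P) + P := by ring
  rw [e]
  refine ⟨?_, ?_, ?_⟩
  · simp
  · simp [coeff_X_pow_mul', coeff_C_mul, coeff_X_mul]
    ring
  · rw [coeff_add, coeff_sub, coeff_C_mul, show (2 : ℕ) = 0 + 2 from rfl, coeff_X_pow_mul, show 0 + 2 = 1 + 1 from rfl, coeff_X_mul]
    ring

/-- **The three bottom coefficients of `P = ∏_{i∈s}(X² − cᵢX + 1)`: `[X⁰]P = 1`, `[X¹]P = −∑ᵢcᵢ`, `[X²]P = |s| + ((∑ᵢcᵢ)² − ∑ᵢcᵢ²)/2 =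
|s| + ∑_{i<j}cᵢc_j`** (induction on `s`). [cite: Ikeda1980, proof of Proposition 1.2 (`a₁ = ∑_l∑ᵢ(γ^{pᵢl} + γ^{−pᵢl})`, `a₂ = ∑_l(∑_{i<j}(γ^{pᵢl} +
γ^{−pᵢl})(γ^{p_jl} + γ^{−p_jl}) + k)`)] -/
theorem coeff_prod_quadratic_zero_one_two [DecidableEq ι] (s : Finset ι) (c : ι → ℝ) :
    (∏ i ∈ s, (X ^ 2 - C (c i) * X + 1 : ℝ[X])).coeff 0 = 1 ∧
      (∏ i ∈ s, (X ^ 2 - C (c i) * X + 1 : ℝ[X])).coeff 1 = -∑ i ∈ s, c i ∧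
        (∏ i ∈ s, (X ^ 2 - C (c i) * X + 1 : ℝ[X])).coeff 2 = s.card + ((∑ i ∈ s, c i) ^ 2 - ∑ i ∈ s, c i ^ 2) / 2 := by
  induction s using Finset.induction_on with
  | empty => simp [coeff_one]
  | insert a s ha ih =>
    obtain ⟨h0, h1, h2⟩ := ih
    rw [prod_insert ha, sum_insert ha, sum_insert ha, card_insert_of_notMem ha]
    obtain ⟨e0, e1, e2⟩ := coeff_quadratic_mul (c a) (∏ i ∈ s, (X ^ 2 - C (c i) * X + 1 : ℝ[X]))
    refine ⟨by rw [e0, h0], by rw [e1, h1, h0]; ring, ?_⟩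
    rw [e2, h2, h1, h0]
    push_cast
    ring

/-- `[X⁰]∏_{i∈s}(X² − cᵢX + 1) = 1`. [cite: Ikeda1980, Proposition 1.2 (ii)] -/
theorem coeff_prod_quadratic_zero [DecidableEq ι] (s : Finset ι) (c : ι → ℝ) :
    (∏ i ∈ s, (X ^ 2 - C (c i) * X + 1 : ℝ[X])).coeff 0 = 1 :=
  (coeff_prod_quadratic_zero_one_two s c).1

/-- `[X¹]∏_{i∈s}(X² − cᵢX + 1) = −∑ᵢcᵢ`. [cite: Ikeda1980, Proposition 1.2 (iii) (proof)] -/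
theorem coeff_prod_quadratic_one [DecidableEq ι] (s : Finset ι) (c : ι → ℝ) :
    (∏ i ∈ s, (X ^ 2 - C (c i) * X + 1 : ℝ[X])).coeff 1 = -∑ i ∈ s, c i :=
  (coeff_prod_quadratic_zero_one_two s c).2.1

/-- `[X²]∏_{i∈s}(X² − cᵢX + 1) = |s| + ((∑ᵢcᵢ)² − ∑ᵢcᵢ²)/2`. [cite: Ikeda1980, Proposition 1.2 (iv) (proof)] -/
theorem coeff_prod_quadratic_two [DecidableEq ι] (s : Finset ι) (c : ι → ℝ) :
    (∏ i ∈ s, (X ^ 2 - C (c i) * X + 1 : ℝ[X])).coeff 2 = s.card + ((∑ i ∈ s, c i) ^ 2 - ∑ i ∈ s, c i ^ 2) / 2 :=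
  (coeff_prod_quadratic_zero_one_two s c).2.2

/-- **`∏_{i∈s}(X² − cᵢX + 1)` is palindromic**: `reverse P = P` ("since `(z − γ^{pl})(z − γ^{−pl}) = (γ^{pl}z − 1)(γ^{−pl}z − 1)`: (i) is easy
to see"). [cite: Ikeda1980, Proposition 1.2 (i) (proof)] -/
theorem reverse_prod_quadratic [DecidableEq ι] (s : Finset ι) (c : ι → ℝ) :
    (∏ i ∈ s, (X ^ 2 - C (c i) * X + 1 : ℝ[X])).reverse = ∏ i ∈ s, (X ^ 2 - C (c i) * X + 1 : ℝ[X]) := by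
  induction s using Finset.induction_on with
  | empty =>
    rw [prod_empty]
    ext n
    rw [coeff_reverse, natDegree_one]
    rcases n with _ | n
    · rw [revAt_le le_rfl]
    · rw [revAt_eq_self_of_lt (Nat.succ_pos n)]
  | insert a s ha ih => rw [prod_insert ha, reverse_mul_of_domain, reverse_quadratic, ih]

/-- **Palindromy coefficientwise: `[X^{2|s|−j}]P = [X^j]P`** for `P = ∏_{i∈s}(X² − cᵢX + 1)` and `j ≤ 2|s|`. [cite: Ikeda1980, Proposition
1.2 (i)] -/
theorem coeff_prod_quadratic_rev [DecidableEq ι] (s : Finset ι) (c : ι → ℝ) {j : ℕ} (hj : j ≤ 2 * s.card) :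
    (∏ i ∈ s, (X ^ 2 - C (c i) * X + 1 : ℝ[X])).coeff (2 * s.card - j) = (∏ i ∈ s, (X ^ 2 - C (c i) * X + 1 : ℝ[X])).coeff j := by
  have h := congrArg (fun P : ℝ[X] ↦ P.coeff j) (reverse_prod_quadratic s c)
  rw [coeff_reverse, natDegree_prod_quadratic, revAt_le hj] at h
  exact h

end Quadratic

/-! ### §2 Proposition 1.2: the coefficients of `Ψ_{q,k}` -/

section PropositionOneTwo

/-- **PROPOSITION 1.2 (i): `Ψ_{q,k}` is palindromic, `[X^j]Ψ_{q,k} = [X^{2k−j}]Ψ_{q,k}`** (`j ≤ 2k`; "(i) `a_i = a_{2k−i}`" for `Ψ_{q,k} =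
∑_{i=0}^{2k}(−1)^i a_i z^{2k−i}`, i.e. `a_i = (−1)^i[X^{2k−i}]Ψ_{q,k}`, and `i ≡ 2k − i (mod 2)`) — for every `q` and all weights.
[cite: Ikeda1980, Proposition 1.2 (i)] -/
theorem coeff_ikedaPolynomial_rev {k : ℕ} (q : ℕ) (ω : Fin k → ℤ) {j : ℕ} (hj : j ≤ 2 * k) :
    (ikedaPolynomial q ω).coeff (2 * k - j) = (ikedaPolynomial q ω).coeff j := by
  unfold ikedaPolynomial
  rw [finsetSum_coeff, finsetSum_coeff]
  refine sum_congr rfl fun l _ ↦ ?_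
  have h := coeff_prod_quadratic_rev (univ : Finset (Fin k)) (fun i ↦ 2 * Real.cos (2 * π * l * ω i / q)) (j := j)
    (by rwa [card_univ, Fintype.card_fin])
  rwa [card_univ, Fintype.card_fin] at h

/-- **`[X⁰]Ψ_{q,k} = q − 1`** (`q ≥ 1`; the constant term of each of the `q − 1` products is `1`). [cite: Ikeda1980, Proposition 1.2 (i)–(ii)] -/
theorem coeff_ikedaPolynomial_zero {k : ℕ} {q : ℕ} (hq : 1 ≤ q) (ω : Fin k → ℤ) :
    (ikedaPolynomial q ω).coeff 0 = (q : ℝ) - 1 := by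
  unfold ikedaPolynomial
  rw [finsetSum_coeff, sum_congr rfl fun (l : ℕ) _ ↦ coeff_prod_quadratic_zero (univ : Finset (Fin k))
    (fun i ↦ 2 * Real.cos (2 * π * l * ω i / q)), sum_const, Nat.card_Ico, nsmul_eq_mul, mul_one, Nat.cast_sub hq, Nat.cast_one]

/-- **PROPOSITION 1.2 (ii): `[X^{2k}]Ψ_{q,k} = a₀ = q − 1`** (`q ≥ 1`). [cite: Ikeda1980, Proposition 1.2 (ii)] -/
theorem coeff_ikedaPolynomial_two_mul {k : ℕ} {q : ℕ} (hq : 1 ≤ q) (ω : Fin k → ℤ) :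
    (ikedaPolynomial q ω).coeff (2 * k) = (q : ℝ) - 1 := by
  have h := coeff_ikedaPolynomial_rev q ω (Nat.zero_le (2 * k))
  rw [Nat.sub_zero] at h
  rw [h, coeff_ikedaPolynomial_zero hq]

/-- `deg Ψ_{q,k} = 2k` for `q ≥ 2` (leading coefficient `q − 1 ≠ 0`). [cite: Ikeda1980, §1 (1.5) and Proposition 1.2 (ii)] -/
theorem natDegree_ikedaPolynomial {k : ℕ} {q : ℕ} (hq : 2 ≤ q) (ω : Fin k → ℤ) : (ikedaPolynomial q ω).natDegree = 2 * k := by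
  refine le_antisymm ?_ (le_natDegree_of_ne_zero ?_)
  · unfold ikedaPolynomial
    refine natDegree_sum_le_of_forall_le _ _ fun l _ ↦ ?_
    rw [natDegree_prod_quadratic, card_univ, Fintype.card_fin]
  · rw [coeff_ikedaPolynomial_two_mul (by omega) ω]
    have : (2 : ℝ) ≤ q := by exact_mod_cast hq
    linarith

/-- `Ψ_{q,k}` has leading coefficient `q − 1` (`q ≥ 2`). [cite: Ikeda1980, Proposition 1.2 (ii)] -/
theorem leadingCoeff_ikedaPolynomial {k : ℕ} {q : ℕ} (hq : 2 ≤ q) (ω : Fin k → ℤ) :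
    (ikedaPolynomial q ω).leadingCoeff = (q : ℝ) - 1 := by
  rw [leadingCoeff, natDegree_ikedaPolynomial hq, coeff_ikedaPolynomial_two_mul (by omega)]

variable {q : ℕ} [hq : Fact q.Prime]

/-- **`[X¹]Ψ_{q,k} = 2k`** for weights `ωᵢ ≢ 0 (mod q)`, `q` prime: `[X¹] = −∑ᵢ∑_{l=1}^{q−1}2cos(2πlωᵢ/q) = −2k·(−1)`. [cite: Ikeda1980,
Proposition 1.2 (iii) (proof: `∑ᵢ∑_l(γ^{pᵢl} + γ^{−pᵢl}) = −2k`)] -/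
theorem coeff_ikedaPolynomial_one {k : ℕ} {ω : Fin k → ℤ} (hω : ∀ i, ¬(q : ℤ) ∣ ω i) :
    (ikedaPolynomial q ω).coeff 1 = 2 * k := by
  unfold ikedaPolynomial
  rw [finsetSum_coeff, sum_congr rfl fun (l : ℕ) _ ↦ coeff_prod_quadratic_one (univ : Finset (Fin k))
    (fun i ↦ 2 * Real.cos (2 * π * l * ω i / q)), sum_neg_distrib, sum_comm]
  simp_rw [← mul_sum, sum_Ico_cos_two_pi_mul_div (hω _)]
  simp

/-- **PROPOSITION 1.2 (iii): `[X^{2k−1}]Ψ_{q,k} = 2k`, i.e. `a₁ = −2k`** (`k ≥ 1`, weights `≢ 0`, `q` prime). [cite: Ikeda1980, Proposition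
1.2 (iii)] -/
theorem coeff_ikedaPolynomial_two_mul_sub_one {k : ℕ} (hk : 1 ≤ k) {ω : Fin k → ℤ} (hω : ∀ i, ¬(q : ℤ) ∣ ω i) :
    (ikedaPolynomial q ω).coeff (2 * k - 1) = 2 * k := by
  rw [coeff_ikedaPolynomial_rev q ω (by omega), coeff_ikedaPolynomial_one hω]

/-- **`[X²]Ψ_{q,k} = k(q − 2k + 1)` on `Ĩ₀(q, k)`** (`q` prime): `[X²] = ∑_l(k + ∑_{i<j}4cos(2πlωᵢ/q)cos(2πlω_j/q)) = k(q−1) − 4·C(k,2)`, using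
`∑_{l=1}^{q−1}cos(2πla/q)cos(2πlb/q) = −1` for `q ∤ a ± b` and `∑_{l=1}^{q−1}cos²(2πla/q) = (q−2)/2`. [cite: Ikeda1980, Proposition 1.2 (iv)
(proof: `a₂ = −2(2·C(k,2)) + k(q−1) = k(q − 2k + 1)`)] -/
theorem IsIkedaWeights.coeff_ikedaPolynomial_two {k : ℕ} {ω : Fin k → ℤ} (hω : IsIkedaWeights q ω) :
    (ikedaPolynomial q ω).coeff 2 = (k : ℝ) * ((q : ℝ) - 2 * k + 1) := by
  have hq1 : 1 ≤ q := hq.out.one_lt.le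
  -- the off-diagonal sums over `l`
  have hoff : ∀ i j : Fin k, i ≠ j →
      ∑ l ∈ Ico 1 q, 2 * Real.cos (2 * π * l * ω i / q) * (2 * Real.cos (2 * π * l * ω j / q)) = -4 := by
    intro i j hij
    have h := sum_Ico_cos_mul_cos (hω.not_dvd_sub i j hij) (hω.not_dvd_add i j hij)
    rw [show ∑ l ∈ Ico 1 q, 2 * Real.cos (2 * π * l * ω i / q) * (2 * Real.cos (2 * π * l * ω j / q)) =
      4 * ∑ l ∈ Ico 1 q, Real.cos (2 * π * l * ω i / q) * Real.cos (2 * π * l * ω j / q) by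
        rw [mul_sum]; exact sum_congr rfl fun l _ ↦ by ring, h]
    norm_num
  -- `(∑ᵢcᵢ)² = ∑ᵢcᵢ² + ∑_{i≠j}cᵢc_j`
  have hsq : ∀ l : ℕ, (∑ i, 2 * Real.cos (2 * π * l * ω i / q)) ^ 2 - ∑ i, (2 * Real.cos (2 * π * l * ω i / q)) ^ 2 =
      ∑ i, ∑ j ∈ univ.erase i, 2 * Real.cos (2 * π * l * ω i / q) * (2 * Real.cos (2 * π * l * ω j / q)) := by
    intro l
    rw [sq, sum_mul_sum, ← sum_sub_distrib]
    refine sum_congr rfl fun i _ ↦ ?_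
    rw [← Finset.sum_erase_add _ _ (mem_univ i), sq]
    ring
  unfold ikedaPolynomial
  rw [finsetSum_coeff, sum_congr rfl fun (l : ℕ) _ ↦ coeff_prod_quadratic_two (univ : Finset (Fin k))
    (fun i ↦ 2 * Real.cos (2 * π * l * ω i / q))]
  simp only [card_univ, Fintype.card_fin]
  simp_rw [hsq]
  rw [sum_add_distrib, sum_const, Nat.card_Ico, nsmul_eq_mul, ← sum_div, sum_comm]
  rw [sum_congr rfl fun (i : Fin k) _ ↦ (sum_comm.trans (sum_congr rfl fun j hj ↦ hoff i j (ne_of_mem_erase hj).symm))]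
  simp only [sum_const, card_erase_of_mem (mem_univ _), card_univ, Fintype.card_fin, nsmul_eq_mul, Nat.cast_sub hq1]
  push_cast
  rcases Nat.eq_zero_or_pos k with rfl | hk
  · simp
  · rw [Nat.cast_sub (show 1 ≤ k from hk)]
    push_cast
    ring

/-- **PROPOSITION 1.2 (iv): `[X^{2k−2}]Ψ_{q,k} = a₂ = k(q − 2k + 1)` on `Ĩ₀(q, k)`** (`k ≥ 1`, `q` prime). [cite: Ikeda1980, Proposition 1.2 (iv)] -/
theorem IsIkedaWeights.coeff_ikedaPolynomial_two_mul_sub_two {k : ℕ} (hk : 1 ≤ k) {ω : Fin k → ℤ} (hω : IsIkedaWeights q ω) :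
    (ikedaPolynomial q ω).coeff (2 * k - 2) = (k : ℝ) * ((q : ℝ) - 2 * k + 1) := by
  rw [coeff_ikedaPolynomial_rev q ω (by omega), hω.coeff_ikedaPolynomial_two]

end PropositionOneTwo

end Literature.Analysis.InnerProduct
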